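import Summits.HubbardSuperconductivity.HubbardSuperconductivity.Theorems.LogColdTorusAverageToEveryKatoSchur
import Summits.HubbardSuperconductivity.HubbardSuperconductivity.Theorems.LogColdTorusAverageToEveryHalfFilling
import Summits.HubbardSuperconductivity.HubbardSuperconductivity.Theorems.LogColdTorusAverageToEveryRegimes
import HarnessLib

/-!
# Route `LogColdTorus`, crux `AverageToEvery` (item `stmt-HubbardSuperconductivity-10519`, shared with route
`AbelianDuality`): the crux closed modulo the DOPED genericity residual only

Helpers (`--supports`) for the crux
`Summit.HubbardSuperconductivity.HubbardSuperconductivity.Theses.LogColdTorus.AverageToEvery`. The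
Kato–Schur closers of `LogColdTorusAverageToEveryKatoSchur.lean` take the irreducibility of the
sector ground eigenspace `E₀(U, L)` (under the joint commutant of `H`, `N̂`, `S^z`, `Δ_d† Δ_d`) at
one coupling of the window as a hypothesis FOR EVERY real `δ`. The calibration files
`LogColdTorusAverageToEveryHalfFilling.lean` (`δ = 0`: Lieb's Theorem 2) and
`LogColdTorusAverageToEveryRegimes.lean` (`|δ| ≥ 1`: vacuum ray / full ray / empty sector) PROVE that
irreducibility — indeed "no proper nonzero subspace at all" — at every coupling on
`δ ∈ (-∞, -1] ∪ {0} ∪ [1, ∞)`. Hence the hypothesis is only needed on the DOPED range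
`0 < |δ| < 1`:

* `averageToEvery_of_dopedIrreducibleGround` — `AverageToEvery` holds as soon as, for every
  `0 < |δ| < 1` and all window data, the window hypothesis yields ONE coupling of the window with
  eventually-irreducible sector ground eigenspaces (the other fillings are discharged here);
* `averageToEvery_of_dopedIrreducibleGroundLaw` — the hypothesis-free form: the DOPED
  irreducible-ground law (for every `0 < |δ| < 1` and every window `(U₁, U₂) ⊂ (0, ∞)` some coupling
  of the window has eventually-irreducible sector ground eigenspaces) implies `AverageToEvery` — this
  is the honest conjecture-grade statement behind the crux, now confined to the fillings where it is
  open;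
* `averageToEvery_of_dopedCountableAccidentalCouplings` — **THE CRUX CLOSED MODULO THE RESHAPED BET
  of line `birth`**: the registered stub `stub_dopedCountableAccidentalCouplings` of
  `Cruxes/AverageToEvery/Lines/birth.lean` (the former `stub_countableAccidentalCouplings` restricted
  to `0 < |δ| < 1`: under the window hypothesis, off countably many couplings per side and from some
  side on, `E₀(U, L)` is irreducible under the joint commutant), taken as a hypothesis, implies
  `AverageToEvery` (countably many countable sets miss a coupling of the window,
  `exists_mem_Ioo_forall_not_mem`).

The doped statement itself (Kato–Rellich genericity of doped repulsive Hubbard tori: no SYSTEMATIC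
inter-block ground degeneracy along infinitely many even sides) is NOT proved here; it is the whole
open content of the crux (`Cruxes/AverageToEvery/PROMOTE-stub_countableAccidentalCouplings.md`,
sibling census `Cruxes/BirEveryGroundState/STRATEGY-CENSUS.md`: kind (A), exact spectral rigidity;
model-free form refuted by `not_abstractDarkPartnerExclusion`).

T. Kato, *Perturbation Theory for Linear Operators* (1966) II §6.1; E. H. Lieb, PRL 62 (1989) 1201,
Theorem 2; H. Tasaki (2020) §2.1, §9.3; T. Koma, H. Tasaki, J. Stat. Phys. 76 (1994) 745, Conj. 10
(context). Folklore; no definition and no named fact is introduced.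
-/

noncomputable section

-- `dupNamespace`: the summit and the problem are both named `HubbardSuperconductivity` (layout D-0022)
set_option linter.dupNamespace false

namespace Summit.HubbardSuperconductivity.HubbardSuperconductivity.Theorems

open Matrix Finset Filter
open Literature.Probability.LatticeModels Literature.MathematicalPhysics.QuantumLattice
open scoped ComplexOrder Matrix Classical

/-- **`AverageToEvery` from irreducible ground multiplets at one coupling — DOPED fillings only.**
If for every `δ` with `0 < |δ| < 1` and all data `(U₁, U₂, c, L₀)`, `0 < U₁ < U₂`, `0 < c`, the
window hypothesis of the crux yields a coupling `U ∈ (U₁, U₂)` and a threshold `L₁` such that for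
every even `L ≥ L₁` the sector ground eigenspace `E₀(U, L)` of `hubbardTorus 2 L 1 U` has no
subspace other than `⊥` and itself invariant under every matrix commuting with `H`, `N̂`, `S^z` and
`Δ_d† Δ_d`, then `AverageToEvery`. The remaining fillings are theorems: `|δ| ≥ 1`
(`irreducibleGround_of_one_le_abs`, any coupling) and `δ = 0` (`irreducibleGround_halfFilling`,
Lieb's Theorem 2, any `U > 0`); `averageToEvery_of_irreducibleGround` concludes.
Lieb, PRL 62 (1989) 1201, Thm 2; Kato (1966) II §6.1. [folklore] -/
theorem averageToEvery_of_dopedIrreducibleGround :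
    (∀ (δ U₁ U₂ c : ℝ) (L₀ : ℕ), 0 < |δ| → |δ| < 1 → 0 < U₁ → U₁ < U₂ → 0 < c →
      (∀ U ∈ Set.Ioo U₁ U₂, ∀ (L : ℕ) [NeZero L], L₀ ≤ L → Even L →
        c * (L : ℝ) ^ 4 ≤ (((hubbardTorus 2 L 1 U).toBlock
          (fun s : Finset (Orb (FermionTorus 2 L)) => s.card = 2 * ⌊(1 - δ) * (L : ℝ) ^ 2 / 2⌋₊ ∧
            2 * (s.filter fun i => (ofLex i).2 = 0).card = 2 * ⌊(1 - δ) * (L : ℝ) ^ 2 / 2⌋₊)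
          (fun s : Finset (Orb (FermionTorus 2 L)) => s.card = 2 * ⌊(1 - δ) * (L : ℝ) ^ 2 / 2⌋₊ ∧
            2 * (s.filter fun i => (ofLex i).2 = 0).card = 2 * ⌊(1 - δ) * (L : ℝ) ^ 2 / 2⌋₊)).groundStateFunctional
          ((((pairField dWaveFormFactor L)ᴴ * pairField dWaveFormFactor L)).toBlock
          (fun s : Finset (Orb (FermionTorus 2 L)) => s.card = 2 * ⌊(1 - δ) * (L : ℝ) ^ 2 / 2⌋₊ ∧
            2 * (s.filter fun i => (ofLex i).2 = 0).card = 2 * ⌊(1 - δ) * (L : ℝ) ^ 2 / 2⌋₊)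
          (fun s : Finset (Orb (FermionTorus 2 L)) => s.card = 2 * ⌊(1 - δ) * (L : ℝ) ^ 2 / 2⌋₊ ∧
            2 * (s.filter fun i => (ofLex i).2 = 0).card = 2 * ⌊(1 - δ) * (L : ℝ) ^ 2 / 2⌋₊))).re) →
      ∃ U ∈ Set.Ioo U₁ U₂, ∃ L₁ : ℕ, ∀ (L : ℕ) [NeZero L], L₁ ≤ L → Even L →
        ∀ K' : Submodule ℂ (Fock (Orb (FermionTorus 2 L))),
          K' ≤ szSector (2 * ⌊(1 - δ) * (L : ℝ) ^ 2 / 2⌋₊) 0 ⊓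
              Module.End.eigenspace (Matrix.toLin' (hubbardTorus 2 L 1 U))
                ((((hubbardTorus 2 L 1 U).minEnergyOn
                  (szSector (2 * ⌊(1 - δ) * (L : ℝ) ^ 2 / 2⌋₊) 0) : ℝ) : ℂ)) →
          (∀ X : Matrix (Finset (Orb (FermionTorus 2 L))) (Finset (Orb (FermionTorus 2 L))) ℂ,
            X * hubbardTorus 2 L 1 U = hubbardTorus 2 L 1 U * X →
            X * totalNumber = totalNumber * X →
            X * HubbardWave0.spinZ = HubbardWave0.spinZ * X →
            X * ((pairField dWaveFormFactor L)ᴴ * pairField dWaveFormFactor L) =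
              (pairField dWaveFormFactor L)ᴴ * pairField dWaveFormFactor L * X →
            ∀ v ∈ K', X *ᵥ v ∈ K') →
          K' = ⊥ ∨
            K' = szSector (2 * ⌊(1 - δ) * (L : ℝ) ^ 2 / 2⌋₊) 0 ⊓
              Module.End.eigenspace (Matrix.toLin' (hubbardTorus 2 L 1 U))
                ((((hubbardTorus 2 L 1 U).minEnergyOn
                  (szSector (2 * ⌊(1 - δ) * (L : ℝ) ^ 2 / 2⌋₊) 0) : ℝ) : ℂ))) →
    Summit.HubbardSuperconductivity.HubbardSuperconductivity.Theses.LogColdTorus.AverageToEvery := by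
  intro hdoped
  refine averageToEvery_of_irreducibleGround fun δ U₁ U₂ c L₀ hU₁ hU₁₂ hc hyp => ?_
  have hmid : (U₁ + U₂) / 2 ∈ Set.Ioo U₁ U₂ := ⟨by linarith, by linarith⟩
  by_cases h1 : 1 ≤ |δ|
  · -- `|δ| ≥ 1`: empty or one-dimensional sectors, any coupling
    obtain ⟨L₁, hL₁⟩ := irreducibleGround_of_one_le_abs h1
    exact ⟨(U₁ + U₂) / 2, hmid, L₁, fun L _ hL hLe K' hK' _ => hL₁ _ L hL hLe K' hK'⟩
  · by_cases h0 : δ = 0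
    · -- half filling: Lieb's Theorem 2, any `U > 0`
      subst h0
      exact ⟨(U₁ + U₂) / 2, hmid, 0, fun L _ _ hLe K' hK' _ =>
        irreducibleGround_halfFilling (hU₁.trans hmid.1) L hLe K' hK'⟩
    · -- the doped range `0 < |δ| < 1`: the hypothesis
      exact hdoped δ U₁ U₂ c L₀ (abs_pos.mpr h0) (not_le.mp h1) hU₁ hU₁₂ hc hyp

/-- **`AverageToEvery` from the DOPED irreducible-ground law** (hypothesis-free, conjecture-grade,
confined to the fillings where it is open): if for every `δ` with `0 < |δ| < 1` and every window
`(U₁, U₂)`, `0 < U₁ < U₂`, some coupling `U` of the window has, from some side on and for all even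
sides, a sector ground eigenspace `E₀(U, L)` irreducible under the joint commutant of `H`, `N̂`,
`S^z`, `Δ_d† Δ_d`, then `AverageToEvery` (the window hypothesis is not even used on the doped
range; the other fillings are theorems). This law is refutable by a hidden-symmetry family of doped
Hubbard tori and is the honest conjecture behind "generic couplings have irreducible ground
multiplets" (Koma–Tasaki (1994) Conj. 10, context). [folklore] -/
theorem averageToEvery_of_dopedIrreducibleGroundLaw :
    (∀ (δ U₁ U₂ : ℝ), 0 < |δ| → |δ| < 1 → 0 < U₁ → U₁ < U₂ →
      ∃ U ∈ Set.Ioo U₁ U₂, ∃ L₁ : ℕ, ∀ (L : ℕ) [NeZero L], L₁ ≤ L → Even L →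
        ∀ K' : Submodule ℂ (Fock (Orb (FermionTorus 2 L))),
          K' ≤ szSector (2 * ⌊(1 - δ) * (L : ℝ) ^ 2 / 2⌋₊) 0 ⊓
              Module.End.eigenspace (Matrix.toLin' (hubbardTorus 2 L 1 U))
                ((((hubbardTorus 2 L 1 U).minEnergyOn
                  (szSector (2 * ⌊(1 - δ) * (L : ℝ) ^ 2 / 2⌋₊) 0) : ℝ) : ℂ)) →
          (∀ X : Matrix (Finset (Orb (FermionTorus 2 L))) (Finset (Orb (FermionTorus 2 L))) ℂ,
            X * hubbardTorus 2 L 1 U = hubbardTorus 2 L 1 U * X →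
            X * totalNumber = totalNumber * X →
            X * HubbardWave0.spinZ = HubbardWave0.spinZ * X →
            X * ((pairField dWaveFormFactor L)ᴴ * pairField dWaveFormFactor L) =
              (pairField dWaveFormFactor L)ᴴ * pairField dWaveFormFactor L * X →
            ∀ v ∈ K', X *ᵥ v ∈ K') →
          K' = ⊥ ∨
            K' = szSector (2 * ⌊(1 - δ) * (L : ℝ) ^ 2 / 2⌋₊) 0 ⊓
              Module.End.eigenspace (Matrix.toLin' (hubbardTorus 2 L 1 U))
                ((((hubbardTorus 2 L 1 U).minEnergyOn
                  (szSector (2 * ⌊(1 - δ) * (L : ℝ) ^ 2 / 2⌋₊) 0) : ℝ) : ℂ))) →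
    Summit.HubbardSuperconductivity.HubbardSuperconductivity.Theses.LogColdTorus.AverageToEvery := by
  intro hlaw
  exact averageToEvery_of_dopedIrreducibleGround
    fun δ U₁ U₂ _ _ hδ0 hδ1 hU₁ hU₁₂ _ _ => hlaw δ U₁ U₂ hδ0 hδ1 hU₁ hU₁₂

/-- **THE CRUX CLOSED MODULO THE RESHAPED BET of line `birth`.** The registered stub
`stub_dopedCountableAccidentalCouplings` of `Cruxes/AverageToEvery/Lines/birth.lean` — for
`0 < |δ| < 1`, under the window hypothesis there are a side `L₁` and COUNTABLE exceptional coupling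
sets `B L` off which, for every even `L ≥ L₁`, the sector ground eigenspace `E₀(U, L)` is irreducible
under the joint commutant — taken as a hypothesis, implies `AverageToEvery`: countably many
countable sets miss a coupling of the (non-degenerate, `U₁ < U₂`) window
(`exists_mem_Ioo_forall_not_mem`), and `averageToEvery_of_dopedIrreducibleGround` concludes (the
fillings `δ = 0` and `|δ| ≥ 1` being theorems). The hypothesis is the crux's whole open content
(Kato–Rellich genericity of DOPED repulsive Hubbard tori; per side, analytic eigen-branches cross at
isolated couplings, Kato (1966) II §6.1, but SYSTEMATIC inter-block ground degeneracy along
infinitely many sides is not excluded by anything in print); it is NOT proved here. [folklore] -/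
theorem averageToEvery_of_dopedCountableAccidentalCouplings :
    (∀ (δ U₁ U₂ c : ℝ) (L₀ : ℕ), 0 < |δ| → |δ| < 1 → 0 < U₁ → U₁ < U₂ → 0 < c →
      (∀ U ∈ Set.Ioo U₁ U₂, ∀ (L : ℕ) [NeZero L], L₀ ≤ L → Even L →
        c * (L : ℝ) ^ 4 ≤ (((hubbardTorus 2 L 1 U).toBlock
          (fun s : Finset (Orb (FermionTorus 2 L)) => s.card = 2 * ⌊(1 - δ) * (L : ℝ) ^ 2 / 2⌋₊ ∧
            2 * (s.filter fun i => (ofLex i).2 = 0).card = 2 * ⌊(1 - δ) * (L : ℝ) ^ 2 / 2⌋₊)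
          (fun s : Finset (Orb (FermionTorus 2 L)) => s.card = 2 * ⌊(1 - δ) * (L : ℝ) ^ 2 / 2⌋₊ ∧
            2 * (s.filter fun i => (ofLex i).2 = 0).card = 2 * ⌊(1 - δ) * (L : ℝ) ^ 2 / 2⌋₊)).groundStateFunctional
          ((((pairField dWaveFormFactor L)ᴴ * pairField dWaveFormFactor L)).toBlock
          (fun s : Finset (Orb (FermionTorus 2 L)) => s.card = 2 * ⌊(1 - δ) * (L : ℝ) ^ 2 / 2⌋₊ ∧
            2 * (s.filter fun i => (ofLex i).2 = 0).card = 2 * ⌊(1 - δ) * (L : ℝ) ^ 2 / 2⌋₊)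
          (fun s : Finset (Orb (FermionTorus 2 L)) => s.card = 2 * ⌊(1 - δ) * (L : ℝ) ^ 2 / 2⌋₊ ∧
            2 * (s.filter fun i => (ofLex i).2 = 0).card = 2 * ⌊(1 - δ) * (L : ℝ) ^ 2 / 2⌋₊))).re) →
      ∃ L₁ : ℕ, ∃ B : ℕ → Set ℝ, (∀ L, (B L).Countable) ∧
        ∀ (L : ℕ) [NeZero L], L₁ ≤ L → Even L → ∀ U ∈ Set.Ioo U₁ U₂, U ∉ B L →
          ∀ K' : Submodule ℂ (Fock (Orb (FermionTorus 2 L))),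
            K' ≤ szSector (2 * ⌊(1 - δ) * (L : ℝ) ^ 2 / 2⌋₊) 0 ⊓
              Module.End.eigenspace (Matrix.toLin' (hubbardTorus 2 L 1 U))
                ((((hubbardTorus 2 L 1 U).minEnergyOn
                  (szSector (2 * ⌊(1 - δ) * (L : ℝ) ^ 2 / 2⌋₊) 0) : ℝ) : ℂ)) →
            (∀ X : Matrix (Finset (Orb (FermionTorus 2 L))) (Finset (Orb (FermionTorus 2 L))) ℂ,
              X * hubbardTorus 2 L 1 U = hubbardTorus 2 L 1 U * X →
              X * totalNumber = totalNumber * X →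
              X * HubbardWave0.spinZ = HubbardWave0.spinZ * X →
              X * ((pairField dWaveFormFactor L)ᴴ * pairField dWaveFormFactor L) =
                (pairField dWaveFormFactor L)ᴴ * pairField dWaveFormFactor L * X →
              ∀ v ∈ K', X *ᵥ v ∈ K') →
            K' = ⊥ ∨
              K' = szSector (2 * ⌊(1 - δ) * (L : ℝ) ^ 2 / 2⌋₊) 0 ⊓
                Module.End.eigenspace (Matrix.toLin' (hubbardTorus 2 L 1 U))
                  ((((hubbardTorus 2 L 1 U).minEnergyOn
                    (szSector (2 * ⌊(1 - δ) * (L : ℝ) ^ 2 / 2⌋₊) 0) : ℝ) : ℂ))) →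
    Summit.HubbardSuperconductivity.HubbardSuperconductivity.Theses.LogColdTorus.AverageToEvery := by
  intro hbet
  refine averageToEvery_of_dopedIrreducibleGround
    fun δ U₁ U₂ c L₀ hδ0 hδ1 hU₁ hU₁₂ hc hyp => ?_
  obtain ⟨L₁, B, hBc, hgood⟩ := hbet δ U₁ U₂ c L₀ hδ0 hδ1 hU₁ hU₁₂ hc hyp
  obtain ⟨U, hU, hUB⟩ := exists_mem_Ioo_forall_not_mem hU₁₂ B hBc
  exact ⟨U, hU, L₁, fun L _ hL hLe => hgood L hL hLe U hU (hUB L)⟩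

end Summit.HubbardSuperconductivity.HubbardSuperconductivity.Theorems

end
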